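import Summits.QuantumFields.YangMills.Theorems.AllWindowsColdBoxBoxMidLineWindow
import Summits.QuantumFields.YangMills.Theorems.AllWindowsColdBoxTiltedCovSecondOrder
import Summits.QuantumFields.YangMills.Theorems.ColdBoxAllGroupsBoxFloorAllGroupsRepresentationGBall
import Summits.QuantumFields.YangMills.Theorems.ColdBoxAllGroupsBoxFloorAllGroupsGoodReductionG
import Summits.QuantumFields.YangMills.Theorems.ColdBoxAllGroupsBoxFloorAllGroupsChartWindowG
import Summits.QuantumFields.YangMills.Theorems.ColdBoxAllGroupsBoxFloorAllGroupsChartDensityJ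
import Summits.QuantumFields.YangMills.Theorems.ColdBoxAllGroupsBoxFloorAllGroupsGaussTailD
import Summits.QuantumFields.YangMills.Theorems.ColdBoxAllGroupsBoxFloorAllGroupsTiltBoundG
import Summits.QuantumFields.YangMills.Theorems.ColdBoxAllGroupsBoxFloorAllGroupsCoreG
import Summits.QuantumFields.YangMills.Theorems.WeakCouplingRatesColdBoxDominationCore
import Mathlib.MeasureTheory.Measure.Tilted
import Mathlib.Probability.ConditionalProbability
import HarnessLib

/-!
# LINE-17 «hypercontractive second-order tilt expansion» on crux `AllWindowsColdBox.BoxMidWindowsSU22` (stmt-QuantumFields-24003):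
# registered stub G `stub_coreBound`, BY NAME

The core of the critic-PASSed LINE-17 (skeleton v3, sha16 `4747b363e792659d`; planner ym-idea-2 g14, critic idea-crit-4 g8 PASS
2026-08-29T05:35Z): from the abstract second-order tilted-covariance bound (A) `TiltedCovSecondOrder`
(`…AllWindowsColdBoxTiltedCov.stub_tiltedCovSecondOrder`, landed), the hypercontractive tilt moments (E) `TiltMoments θ` and the
Gaussian-side terms (F) `GaussSideTerms θ` (both still open obligations of the line, taken here as hypotheses exactly as registered),
the absolute ONE-SCALE Dirichlet comparison `CoreBound θ` — `|β²·boxPlaqCov ρ₂ β ⌈β^θ⌉ T − ¾·boxDirCircSqCov ⌈β^θ⌉ T| ≤ K·⌈β^θ⌉⁶/β`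
uniformly in `T ≤ ⌈β^θ⌉`, eventually in `β` — follows for every `0 < θ ≤ 1/16`.

Route (the tree's B9c assembly `…StubBoxDirichletDominationAbsG` with (A) in place of the first-order sup bookkeeping of B9a): chart
density (B5-J `exists_chartMeasureE_restrict_closedBall_eq_withDensity`) → an `AdmissibleDensity`, hence the constants of E and F;
thresholds: the link window (`eventually_linkWindow_subset_image_expChart` at `κ = min (1/8) (r₂/2)`), the conditioning error B2
(`abs_boxPlaqCov_sub_cond_le_of_rep`), `boxState_coldGoodSetG_ne_zero`, and the exponent window `eventually_lineWindow`; for `β` beyond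
all of them: the conditioning event has positive Gaussian mass (`gaussD_real_compl_goodTE_inter_ball_le` at `R = β^θ`), the conditioned
box state integrates gauge-invariant nonnegative observables as the tilted conditioned Gaussian (B4′
`integral_cond_boxState_eq_integral_tilted_G'` at `r = 2η`), that tilted measure IS `(lineGauss θ β).tilted (centredTilt θ β J)`
(`tilted_congr`, `tilted_tilted`, `tilted_const`), the tilt and the observables are bounded on the event (`abs_tiltWE_le`,
`abs_plaqCostAt_leG`), so (A) applies with `∫ W⁸ ≤ 1`; adding F(ii), F(iii) and B2 gives the bound with `K = 1 + 8·K_F²·K_E + 2·K_F`.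

HONEST LABEL: ONE registered stub (the M-sized plumbing step) of one critic-PASSed line on the R2ξ″ RECORD-rung crux 24003; the line
stays open at its load-bearing stubs E and F; no crux, rung or summit is proved here; the Yang–Mills mass gap is NOT proved by this file.
-/

set_option autoImplicit false

noncomputable section

open MeasureTheory ProbabilityTheory
open Literature.MathematicalPhysics.QuantumLattice
open Literature.MathematicalPhysics.QuantumFieldTheory
open Literature.MathematicalPhysics.QuantumFieldTheory.LatticeMaxwell
open Summit.QuantumFields.YangMills.Theorems.WeakCouplingRates
open Summit.QuantumFields.YangMills.Theorems.ColdBoxAllGroups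
open Summit.QuantumFields.YangMills.Theorems.FreeEnergyLogCoefficient

namespace Summit.QuantumFields.YangMills.Theorems.AllWindowsColdBoxBoxMidLine

open Filter Topology Metric
open Summit.QuantumFields.YangMills.Theorems.AllWindowsColdBoxTiltedCov (TiltedCovSecondOrder)

/-- **STUB G of LINE-17 «hypercontractive second-order tilt expansion» (stmt-QuantumFields-24003), by name and signature: the core.**
From the abstract second-order tilted-covariance bound (A), the hypercontractive tilt moments (E) and the Gaussian-side terms (F), the
absolute one-scale Dirichlet comparison with rate `K·⌈β^θ⌉⁶/β` follows by the tree's pipeline: chart density (B5-J), link window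
(ChartWindowG), representation of the conditioned box state as the tilted conditioned Gaussian (B4′), large-field conditioning (B2), the
identification of the tilted measure with `lineGauss.tilted centredTilt`, and (A) in place of the first-order sup bookkeeping of B9a. -/
theorem stub_coreBound : TiltedCovSecondOrder → ∀ θ : ℝ, 0 < θ → θ ≤ 1 / 16 → TiltMoments θ → GaussSideTerms θ → CoreBound θ := by
  intro hA θ hθ hθ16 hE hF
  haveI : SecondCountableTopology (Matrix (Fin 2) (Fin 2) ℂ) := inferInstanceAs (SecondCountableTopology (Fin 2 → Fin 2 → ℂ))
  haveI : SecondCountableTopology SU2 := inferInstance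
  have hρc : Continuous ρ₂ := continuous_fundamentalRep (Fin 2)
  have hinj : Function.Injective ρ₂ := fundamentalRep_injective (Fin 2)
  have hρu : ∀ g, ρ₂ g ∈ Matrix.unitaryGroup (Fin 2) ℂ := fundamentalRep_mem_unitaryGroup
  -- the chart density (B5-J) and the data of E, F
  obtain ⟨r₂, C₂, cH, hr₂, -, hC₂, hcH, J, hJc, hJb, hJhalf, hdens⟩ :=
    exists_chartMeasureE_restrict_closedBall_eq_withDensity ρ₂ hρc hinj hρu
  have hadm : AdmissibleDensity r₂ C₂ J := ⟨hr₂, hC₂, hJc, hJb, hJhalf⟩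
  obtain ⟨KE, βE, hKE, hEβ⟩ := hE r₂ C₂ J hadm
  obtain ⟨KF, βF, hKF, hFβ⟩ := hF r₂ C₂ J hadm
  -- thresholds
  have hε2 : 2 * θ < epsOf θ := by unfold epsOf; linarith
  have hεpos : 0 < epsOf θ := by unfold epsOf; linarith
  have hwin2 : 2 * θ + epsOf θ < 1 / 2 := by unfold epsOf; linarith
  have hκ : 0 < min (1 / 8 : ℝ) (r₂ / 2) := lt_min (by norm_num) (by linarith)
  obtain ⟨β₁, hlinkE⟩ := Filter.eventually_atTop.1
    (eventually_linkWindow_subset_image_expChart ρ₂ hρc hinj hρu hθ.le hwin2 hκ)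
  obtain ⟨β₂, hcondE⟩ := abs_boxPlaqCov_sub_cond_le_of_rep ρ₂ hρc hρu hθ hε2
  obtain ⟨β₃, hG0E⟩ := boxState_coldGoodSetG_ne_zero ρ₂ hρc hρu hθ hε2
  obtain ⟨β₄, hwinE⟩ := eventually_lineWindow hθ hθ16 KE
  refine ⟨1 + 8 * KF ^ 2 * KE + 2 * KF, max (max (max β₁ β₂) (max β₃ β₄)) (max βE βF), by positivity, fun β hβ T hT => ?_⟩
  have hb₁ : β₁ ≤ β := le_trans (le_trans (le_max_left _ _) (le_max_left _ _)) (le_trans (le_max_left _ _) hβ)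
  have hb₂ : β₂ ≤ β := le_trans (le_trans (le_max_right _ _) (le_max_left _ _)) (le_trans (le_max_left _ _) hβ)
  have hb₃ : β₃ ≤ β := le_trans (le_trans (le_max_left _ _) (le_max_right _ _)) (le_trans (le_max_left _ _) hβ)
  have hb₄ : β₄ ≤ β := le_trans (le_trans (le_max_right _ _) (le_max_right _ _)) (le_trans (le_max_left _ _) hβ)
  have hbE : βE ≤ β := le_trans (le_max_left _ _) (le_trans (le_max_right _ _) hβ)
  have hbF : βF ≤ β := le_trans (le_max_right _ _) (le_trans (le_max_right _ _) hβ)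
  obtain ⟨hβ1, hmEm, hwin, hp1, hKE1, hc₀⟩ := hwinE β hb₄
  obtain ⟨hηκ, hball⟩ := hlinkE β hb₁
  obtain ⟨hW8, hWexp⟩ := hEβ β hbE
  obtain ⟨hF4, hG4, hFii, hFiii⟩ := hFβ β hbF T hT
  have hβ0 : 0 < β := by linarith
  -- no `set` abbreviations (they are expensive here): H = ⌈β^θ⌉₊, S = lineEvent θ β, ν = lineGauss θ β, W = centredTilt θ β J
  have hHr : (1 : ℝ) ≤ (⌈β ^ θ⌉₊ : ℝ) := (one_le_ceil_rpow_and_le hβ1 hθ.le).1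
  have hH : 1 ≤ ⌈β ^ θ⌉₊ := by exact_mod_cast hHr
  have hη0 : 0 < etaOf β ⌈β ^ θ⌉₊ (epsOf θ) := by
    unfold etaOf
    have : 0 < Real.sqrt (β ^ (2 * (epsOf θ) - 1)) := Real.sqrt_pos.2 (Real.rpow_pos_of_pos hβ0 _)
    positivity
  have hm0 : 0 < 2 * etaOf β ⌈β ^ θ⌉₊ (epsOf θ) := by positivity
  have hηκ' : etaOf β ⌈β ^ θ⌉₊ (epsOf θ) ≤ min (1 / 8) (r₂ / 2) := hηκ
  have hm4 : 2 * etaOf β ⌈β ^ θ⌉₊ (epsOf θ) ≤ 1 / 4 := by linarith [hηκ'.trans (min_le_left _ _)]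
  have hmr₂ : 2 * etaOf β ⌈β ^ θ⌉₊ (epsOf θ) ≤ r₂ := by linarith [hηκ'.trans (min_le_right _ _)]
  have hSm : MeasurableSet (lineEvent θ β) :=
    (measurableSet_goodTE ρ₂ hρc hinj β (epsOf θ)).inter (measurableSet_ball_unscaleTE (dimE ρ₂) β (2 * etaOf β ⌈β ^ θ⌉₊ (epsOf θ)))
  haveI : IsProbabilityMeasure (gaussD ⌈β ^ θ⌉₊ (dimE ρ₂)) := isProbabilityMeasure_gaussD ⌈β ^ θ⌉₊ (dimE ρ₂)
  -- `(gaussD ⌈β ^ θ⌉₊ (dimE ρ₂))((lineEvent θ β)) ≠ 0` from the Gaussian tail at `R = β^θ`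
  have hR0 : (0 : ℝ) ≤ β ^ θ := Real.rpow_nonneg hβ0.le _
  have hmE4 : Real.sqrt (dimE ρ₂) * ((12 * (⌈β ^ θ⌉₊ : ℝ) ^ 2 + 2 * ⌈β ^ θ⌉₊ + 1) * β ^ θ) / Real.sqrt β ≤ 1 / 4 := hmEm.trans hm4
  have hpS : (gaussD ⌈β ^ θ⌉₊ (dimE ρ₂)).real (lineEvent θ β)ᶜ ≤ 240 * (dimE ρ₂) * (2 * (⌈β ^ θ⌉₊ : ℝ) + 1) ^ 4 * Real.exp (-(β ^ θ) ^ 2 / 2) :=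
    gaussD_real_compl_goodTE_inter_ball_le ρ₂ hρc hβ0 hH hR0 hmE4 hmEm hwin
  have hγS : (gaussD ⌈β ^ θ⌉₊ (dimE ρ₂)) (lineEvent θ β) ≠ 0 := measure_ne_zero_of_real_compl_lt_one (gaussD ⌈β ^ θ⌉₊ (dimE ρ₂)) hSm (hpS.trans_lt hp1)
  haveI hνP : IsProbabilityMeasure (lineGauss θ β) := cond_isProbabilityMeasure hγS
  have haeS : ∀ᵐ t ∂(lineGauss θ β), t ∈ (lineEvent θ β) := ae_cond_mem hSm
  -- the representation (B4′)
  have hgpos : ∀ a : EuclideanSpace ℝ (Fin (dimE ρ₂)), ‖a‖ ≤ 2 * etaOf β ⌈β ^ θ⌉₊ (epsOf θ) → 0 < J a := fun a ha => by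
    linarith [(hJhalf a (ha.trans hmr₂)).1]
  have hc0 : ENNReal.ofReal cH ≠ 0 := by rw [ENNReal.ofReal_ne_zero_iff]; exact hcH
  have hG0 : boxState ρ₂ β ⌈β ^ θ⌉₊ (coldGoodSetG ρ₂ ⌈β ^ θ⌉₊ β (epsOf θ)) ≠ 0 := hG0E β hb₃
  have hrep : ∀ X : LGConfig 4 SU2 → ℝ, Measurable X → IsZdGaugeInvariant X → (∀ U, 0 ≤ X U) →
      ∫ U, X U ∂((boxState ρ₂ β ⌈β ^ θ⌉₊)[|coldGoodSetG ρ₂ ⌈β ^ θ⌉₊ β (epsOf θ)]) =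
        ∫ t, X (cfgTE ρ₂ ⌈β ^ θ⌉₊ β t) ∂(((gaussD ⌈β ^ θ⌉₊ (dimE ρ₂))[|(lineEvent θ β)]).tilted ((lineEvent θ β).indicator (tiltWE ρ₂ ⌈β ^ θ⌉₊ J β))) :=
    fun X hXm hXinv hX0 => integral_cond_boxState_eq_integral_tilted_G' ρ₂ hρc hinj hρu hβ0 hH hm4 hball hJc.measurable hgpos hc0
      ENNReal.ofReal_ne_top (hdens _ hm0 hmr₂) hG0 hγS hXm hXinv hX0
  -- bounds on `(lineEvent θ β)`: the tilt and the observables are bounded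
  have hg : ∀ a : EuclideanSpace ℝ (Fin (dimE ρ₂)), ‖a‖ ≤ 2 * etaOf β ⌈β ^ θ⌉₊ (epsOf θ) → |Real.log (J a)| ≤ 2 * C₂ * (2 * etaOf β ⌈β ^ θ⌉₊ (epsOf θ)) ^ 2 :=
    fun a ha => by
    refine (abs_log_jacobian_le hJb hJhalf a (ha.trans hmr₂)).trans ?_
    have : ‖a‖ ^ 2 ≤ (2 * etaOf β ⌈β ^ θ⌉₊ (epsOf θ)) ^ 2 := pow_le_pow_left₀ (norm_nonneg _) ha 2
    exact mul_le_mul_of_nonneg_left this (by positivity)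
  obtain ⟨w, hw⟩ : ∃ w : ℝ, (Finset.card (plaquettesTouching (AxialGauge.boxEdges 4 (2 * ⌈β ^ θ⌉₊ + 1))) : ℝ) *
      (190 * β * (2 * etaOf β ⌈β ^ θ⌉₊ (epsOf θ)) ^ 3) + (Fintype.card (ColdFreeIdx ⌈β ^ θ⌉₊) : ℝ) * (2 * C₂ * (2 * etaOf β ⌈β ^ θ⌉₊ (epsOf θ)) ^ 2) = w := ⟨_, rfl⟩
  have hTb : ∀ t ∈ (lineEvent θ β), |tiltWE ρ₂ ⌈β ^ θ⌉₊ J β t| ≤ w := fun t ht => by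
    have h := abs_tiltWE_le ρ₂ hρc hβ0 hm0.le hm4 hg t ht.2
    rw [hw] at h; exact h
  have hTm : Measurable (tiltWE ρ₂ ⌈β ^ θ⌉₊ J β) := measurable_tiltWE ρ₂ hρc hinj hJc.measurable β
  have hTae : ∀ᵐ t ∂(lineGauss θ β), ‖tiltWE ρ₂ ⌈β ^ θ⌉₊ J β t‖ ≤ w := haeS.mono fun t ht => by rw [Real.norm_eq_abs]; exact hTb t ht
  have hTint : Integrable (tiltWE ρ₂ ⌈β ^ θ⌉₊ J β) (lineGauss θ β) := Integrable.of_bound hTm.aestronglyMeasurable w hTae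
  have hWeq : ∀ t, (centredTilt θ β J) t = tiltWE ρ₂ ⌈β ^ θ⌉₊ J β t - ∫ s, tiltWE ρ₂ ⌈β ^ θ⌉₊ J β s ∂(lineGauss θ β) := fun t => rfl
  have hcw : |∫ s, tiltWE ρ₂ ⌈β ^ θ⌉₊ J β s ∂(lineGauss θ β)| ≤ w := by
    have h := norm_integral_le_of_norm_le_const hTae
    rw [probReal_univ, mul_one, Real.norm_eq_abs] at h
    exact h
  have hWm : Measurable (centredTilt θ β J) := hTm.sub measurable_const
  have hWae : ∀ᵐ t ∂(lineGauss θ β), ‖(centredTilt θ β J) t‖ ≤ 2 * w := hTae.mono fun t ht => by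
    rw [Real.norm_eq_abs] at ht ⊢
    rw [hWeq]
    have := abs_sub (tiltWE ρ₂ ⌈β ^ θ⌉₊ J β t) (∫ s, tiltWE ρ₂ ⌈β ^ θ⌉₊ J β s ∂(lineGauss θ β))
    linarith
  have hW0 : ∫ t, (centredTilt θ β J) t ∂(lineGauss θ β) = 0 := by
    simp_rw [hWeq]
    rw [integral_sub hTint (integrable_const _), integral_const, probReal_univ, one_smul, sub_self]
  have hWexpI : Integrable (fun t => Real.exp (4 * |(centredTilt θ β J) t|)) (lineGauss θ β) := by
    refine Integrable.of_bound
      (Real.continuous_exp.measurable.comp (measurable_const.mul (continuous_abs.measurable.comp hWm))).aestronglyMeasurable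
      (Real.exp (4 * (2 * w))) (hWae.mono fun t ht => ?_)
    rw [Real.norm_eq_abs] at ht
    rw [Real.norm_eq_abs, abs_of_nonneg (Real.exp_pos _).le]
    exact Real.exp_le_exp.2 (by linarith)
  have hWexp1 : Integrable (fun t => Real.exp ((centredTilt θ β J) t)) (lineGauss θ β) := by
    refine Integrable.of_bound (Real.continuous_exp.measurable.comp hWm).aestronglyMeasurable (Real.exp (2 * w)) (hWae.mono fun t ht => ?_)
    rw [Real.norm_eq_abs] at ht
    rw [Real.norm_eq_abs, abs_of_nonneg (Real.exp_pos _).le]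
    exact Real.exp_le_exp.2 ((le_abs_self _).trans ht)
  have hW8m : MemLp (centredTilt θ β J) 8 (lineGauss θ β) := MemLp.of_bound hWm.aestronglyMeasurable (2 * w) hWae
  -- the observables
  have hobs : ∀ x : Literature.Probability.LatticeModels.Site 4,
      Measurable (fun t : TSpaceD ⌈β ^ θ⌉₊ (dimE ρ₂) => β * plaqCostAt ρ₂ x 1 2 (cfgTE ρ₂ ⌈β ^ θ⌉₊ β t)) ∧
      (∀ t, ‖β * plaqCostAt ρ₂ x 1 2 (cfgTE ρ₂ ⌈β ^ θ⌉₊ β t)‖ ≤ β * (2 * 2)) := fun x => by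
    refine ⟨((measurable_plaqCostAt_of_continuous ρ₂ hρc x 1 2).const_mul β).comp (measurable_cfgTE ρ₂ hρc hinj β), fun t => ?_⟩
    rw [Real.norm_eq_abs, abs_mul, abs_of_pos hβ0]
    exact mul_le_mul_of_nonneg_left (by exact_mod_cast abs_plaqCostAt_leG ρ₂ hρu x 1 2 (cfgTE ρ₂ ⌈β ^ θ⌉₊ β t)) hβ0.le
  -- (terms mentioning the translated site are pre-elaborated WITHOUT expected type: elaborating them against an expected type is
  -- pathologically slow here)
  have hobsF := hobs (boxCentre ⌈β ^ θ⌉₊)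
  have hobsG := hobs (boxCentre ⌈β ^ θ⌉₊ + Pi.single 0 (T : ℤ))
  have hfm : Measurable (obsF θ β) := hobsF.1
  have hgm : Measurable (obsG θ β T) := hobsG.1
  have hf4 : MemLp (obsF θ β) 4 (lineGauss θ β) :=
    MemLp.of_bound hfm.aestronglyMeasurable (β * (2 * 2)) (ae_of_all _ fun t => hobsF.2 t)
  have hg4 : MemLp (obsG θ β T) 4 (lineGauss θ β) :=
    MemLp.of_bound hgm.aestronglyMeasurable (β * (2 * 2)) (ae_of_all _ fun t => hobsG.2 t)
  -- `∫ W⁸ ≤ 1`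
  have hW8le : ∫ t, (centredTilt θ β J) t ^ 8 ∂(lineGauss θ β) ≤ 1 := by
    have h0 : 0 ≤ ∫ t, (centredTilt θ β J) t ^ 8 ∂(lineGauss θ β) := integral_nonneg fun t => by positivity
    have h1 : (∫ t, (centredTilt θ β J) t ^ 8 ∂(lineGauss θ β)) ^ (1 / 4 : ℝ) ≤ 1 := hW8.trans hKE1
    have h2 : ∫ t, (centredTilt θ β J) t ^ 8 ∂(lineGauss θ β) = ((∫ t, (centredTilt θ β J) t ^ 8 ∂(lineGauss θ β)) ^ (1 / 4 : ℝ)) ^ 4 := by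
      rw [← Real.rpow_natCast, ← Real.rpow_mul h0]; norm_num
    rw [h2]
    have h3 : 0 ≤ (∫ t, (centredTilt θ β J) t ^ 8 ∂(lineGauss θ β)) ^ (1 / 4 : ℝ) := Real.rpow_nonneg h0 _
    calc ((∫ t, (centredTilt θ β J) t ^ 8 ∂(lineGauss θ β)) ^ (1 / 4 : ℝ)) ^ 4 ≤ (1 : ℝ) ^ 4 := pow_le_pow_left₀ h3 h1 4
      _ = 1 := one_pow 4
  -- (A)
  have hAb := hA (TSpaceD ⌈β ^ θ⌉₊ (dimE ρ₂)) (lineGauss θ β) (centredTilt θ β J) (obsF θ β) (obsG θ β T) hWm hfm hgm hW0 hWexpI hW8m hf4 hg4 hW8le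
  -- identification of the tilted measure
  have htilt : ((gaussD ⌈β ^ θ⌉₊ (dimE ρ₂))[|(lineEvent θ β)]).tilted ((lineEvent θ β).indicator (tiltWE ρ₂ ⌈β ^ θ⌉₊ J β)) = (lineGauss θ β).tilted (centredTilt θ β J) := by
    have h1 : ((gaussD ⌈β ^ θ⌉₊ (dimE ρ₂))[|(lineEvent θ β)]).tilted ((lineEvent θ β).indicator (tiltWE ρ₂ ⌈β ^ θ⌉₊ J β)) = (lineGauss θ β).tilted (tiltWE ρ₂ ⌈β ^ θ⌉₊ J β) :=
      tilted_congr (haeS.mono fun t ht => Set.indicator_of_mem ht _)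
    have h2 : tiltWE ρ₂ ⌈β ^ θ⌉₊ J β = (centredTilt θ β J) + fun _ => ∫ s, tiltWE ρ₂ ⌈β ^ θ⌉₊ J β s ∂(lineGauss θ β) := by funext t; simp [hWeq]
    rw [h1, h2, ← tilted_tilted hWexp1]
    haveI : IsProbabilityMeasure ((lineGauss θ β).tilted (centredTilt θ β J)) := isProbabilityMeasure_tilted hWexp1
    exact tilted_const _ _
  -- the three integrals of the costs
  have hnn : ∀ (x : Literature.Probability.LatticeModels.Site 4) (U : LGConfig 4 SU2), 0 ≤ β * plaqCostAt ρ₂ x 1 2 U := fun x U => by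
    refine mul_nonneg hβ0.le ?_
    simp only [plaqCostAt, plaquetteObs]
    rw [Literature.MathematicalPhysics.QuantumFieldTheory.sub_re_trace_eq_half_norm_sub_one_sq (hρu _)]
    positivity
  have hmeasU : ∀ x : Literature.Probability.LatticeModels.Site 4, Measurable fun U : LGConfig 4 SU2 => β * plaqCostAt ρ₂ x 1 2 U :=
    fun x => (measurable_plaqCostAt_of_continuous ρ₂ hρc x 1 2).const_mul β
  have hinvF := isZdGaugeInvariant_const_mul_plaqCostAtG ρ₂ β (boxCentre ⌈β ^ θ⌉₊) 1 2
  have hinvG := isZdGaugeInvariant_const_mul_plaqCostAtG ρ₂ β (boxCentre ⌈β ^ θ⌉₊ + Pi.single 0 (T : ℤ)) 1 2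
  have hinvFG := isZdGaugeInvariant_const_mul_plaqCostAt_mulG ρ₂ β (boxCentre ⌈β ^ θ⌉₊) (boxCentre ⌈β ^ θ⌉₊ + Pi.single 0 (T : ℤ)) 1 2 1 2
  have hmeasF := hmeasU (boxCentre ⌈β ^ θ⌉₊)
  have hmeasG := hmeasU (boxCentre ⌈β ^ θ⌉₊ + Pi.single 0 (T : ℤ))
  have hnnF := hnn (boxCentre ⌈β ^ θ⌉₊)
  have hnnG := hnn (boxCentre ⌈β ^ θ⌉₊ + Pi.single 0 (T : ℤ))
  have hrepF : ∫ U, β * plaqCostAt ρ₂ (boxCentre ⌈β ^ θ⌉₊) 1 2 U ∂((boxState ρ₂ β ⌈β ^ θ⌉₊)[|coldGoodSetG ρ₂ ⌈β ^ θ⌉₊ β (epsOf θ)]) =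
      ∫ t, obsF θ β t ∂((lineGauss θ β).tilted (centredTilt θ β J)) := by
    rw [← htilt]
    exact hrep _ hmeasF hinvF hnnF
  have hrepG : ∫ U, β * plaqCostAt ρ₂ (boxCentre ⌈β ^ θ⌉₊ + Pi.single 0 (T : ℤ)) 1 2 U ∂((boxState ρ₂ β ⌈β ^ θ⌉₊)[|coldGoodSetG ρ₂ ⌈β ^ θ⌉₊ β (epsOf θ)]) =
      ∫ t, obsG θ β T t ∂((lineGauss θ β).tilted (centredTilt θ β J)) := by
    rw [← htilt]
    exact hrep _ hmeasG hinvG hnnG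
  have hrepFG : ∫ U, β * plaqCostAt ρ₂ (boxCentre ⌈β ^ θ⌉₊) 1 2 U * (β * plaqCostAt ρ₂ (boxCentre ⌈β ^ θ⌉₊ + Pi.single 0 (T : ℤ)) 1 2 U)
      ∂((boxState ρ₂ β ⌈β ^ θ⌉₊)[|coldGoodSetG ρ₂ ⌈β ^ θ⌉₊ β (epsOf θ)]) = ∫ t, obsF θ β t * obsG θ β T t ∂((lineGauss θ β).tilted (centredTilt θ β J)) := by
    rw [← htilt]
    exact hrep _ (hmeasF.mul hmeasG) hinvFG (fun U => mul_nonneg (hnnF U) (hnnG U))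
  -- assemble
  have hcondT := hcondE β hb₂ T
  have hdecomp : β ^ 2 * boxPlaqCov ρ₂ β ⌈β ^ θ⌉₊ T - 3 / 4 * boxDirCircSqCov ⌈β ^ θ⌉₊ T =
      β ^ 2 * (boxPlaqCov ρ₂ β ⌈β ^ θ⌉₊ T -
        ((∫ U, plaqCostAt ρ₂ (boxCentre ⌈β ^ θ⌉₊) 1 2 U * plaqCostAt ρ₂ (boxCentre ⌈β ^ θ⌉₊ + Pi.single 0 (T : ℤ)) 1 2 U
            ∂((boxState ρ₂ β ⌈β ^ θ⌉₊)[|coldGoodSetG ρ₂ ⌈β ^ θ⌉₊ β (epsOf θ)])) -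
          (∫ U, plaqCostAt ρ₂ (boxCentre ⌈β ^ θ⌉₊) 1 2 U ∂((boxState ρ₂ β ⌈β ^ θ⌉₊)[|coldGoodSetG ρ₂ ⌈β ^ θ⌉₊ β (epsOf θ)])) *
          (∫ U, plaqCostAt ρ₂ (boxCentre ⌈β ^ θ⌉₊ + Pi.single 0 (T : ℤ)) 1 2 U ∂((boxState ρ₂ β ⌈β ^ θ⌉₊)[|coldGoodSetG ρ₂ ⌈β ^ θ⌉₊ β (epsOf θ)])))) +
      ((((∫ t, obsF θ β t * obsG θ β T t ∂((lineGauss θ β).tilted (centredTilt θ β J))) - (∫ t, obsF θ β t ∂((lineGauss θ β).tilted (centredTilt θ β J))) * (∫ t, obsG θ β T t ∂((lineGauss θ β).tilted (centredTilt θ β J)))) -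
          ((∫ t, obsF θ β t * obsG θ β T t ∂(lineGauss θ β)) - (∫ t, obsF θ β t ∂(lineGauss θ β)) * (∫ t, obsG θ β T t ∂(lineGauss θ β))) -
          ∫ t, (obsF θ β t - ∫ s, obsF θ β s ∂(lineGauss θ β)) * (obsG θ β T t - ∫ s, obsG θ β T s ∂(lineGauss θ β)) * (centredTilt θ β J) t ∂(lineGauss θ β)) +
        (∫ t, (obsF θ β t - ∫ s, obsF θ β s ∂(lineGauss θ β)) * (obsG θ β T t - ∫ s, obsG θ β T s ∂(lineGauss θ β)) * (centredTilt θ β J) t ∂(lineGauss θ β)) +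
        (((∫ t, obsF θ β t * obsG θ β T t ∂(lineGauss θ β)) - (∫ t, obsF θ β t ∂(lineGauss θ β)) * (∫ t, obsG θ β T t ∂(lineGauss θ β))) -
          3 / 4 * boxDirCircSqCov ⌈β ^ θ⌉₊ T)) := by
    rw [← hrepF, ← hrepG, ← hrepFG, ← sq_mul_cov_eq]
    ring
  rw [hdecomp]
  -- the four pieces
  have hH6 : (1 : ℝ) ≤ (⌈β ^ θ⌉₊ : ℝ) ^ 6 := one_le_pow₀ hHr
  have p1 : |β ^ 2 * (boxPlaqCov ρ₂ β ⌈β ^ θ⌉₊ T -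
        ((∫ U, plaqCostAt ρ₂ (boxCentre ⌈β ^ θ⌉₊) 1 2 U * plaqCostAt ρ₂ (boxCentre ⌈β ^ θ⌉₊ + Pi.single 0 (T : ℤ)) 1 2 U
            ∂((boxState ρ₂ β ⌈β ^ θ⌉₊)[|coldGoodSetG ρ₂ ⌈β ^ θ⌉₊ β (epsOf θ)])) -
          (∫ U, plaqCostAt ρ₂ (boxCentre ⌈β ^ θ⌉₊) 1 2 U ∂((boxState ρ₂ β ⌈β ^ θ⌉₊)[|coldGoodSetG ρ₂ ⌈β ^ θ⌉₊ β (epsOf θ)])) *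
          (∫ U, plaqCostAt ρ₂ (boxCentre ⌈β ^ θ⌉₊ + Pi.single 0 (T : ℤ)) 1 2 U ∂((boxState ρ₂ β ⌈β ^ θ⌉₊)[|coldGoodSetG ρ₂ ⌈β ^ θ⌉₊ β (epsOf θ)]))))| ≤
      1 * (⌈β ^ θ⌉₊ : ℝ) ^ 6 / β := by
    rw [abs_mul, abs_of_nonneg (by positivity : (0 : ℝ) ≤ β ^ 2)]
    refine (mul_le_mul_of_nonneg_left hcondT (by positivity)).trans (hc₀.trans ?_)
    rw [one_mul]; exact div_le_div_of_nonneg_right hH6 hβ0.le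
  have hexp2 : (∫ t, Real.exp (4 * |(centredTilt θ β J) t|) ∂(lineGauss θ β)) ^ (1 / 2 : ℝ) ≤ 2 := by
    have h0 : 0 ≤ ∫ t, Real.exp (4 * |(centredTilt θ β J) t|) ∂(lineGauss θ β) := integral_nonneg fun t => (Real.exp_pos _).le
    calc (∫ t, Real.exp (4 * |(centredTilt θ β J) t|) ∂(lineGauss θ β)) ^ (1 / 2 : ℝ) ≤ (4 : ℝ) ^ (1 / 2 : ℝ) := Real.rpow_le_rpow h0 hWexp (by norm_num)
      _ = 2 := by rw [show (4 : ℝ) = 2 ^ 2 by norm_num, ← Real.rpow_natCast, ← Real.rpow_mul (by norm_num)]; norm_num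
  have p2 : |(((∫ t, obsF θ β t * obsG θ β T t ∂((lineGauss θ β).tilted (centredTilt θ β J))) - (∫ t, obsF θ β t ∂((lineGauss θ β).tilted (centredTilt θ β J))) * (∫ t, obsG θ β T t ∂((lineGauss θ β).tilted (centredTilt θ β J)))) -
          ((∫ t, obsF θ β t * obsG θ β T t ∂(lineGauss θ β)) - (∫ t, obsF θ β t ∂(lineGauss θ β)) * (∫ t, obsG θ β T t ∂(lineGauss θ β))) -
          ∫ t, (obsF θ β t - ∫ s, obsF θ β s ∂(lineGauss θ β)) * (obsG θ β T t - ∫ s, obsG θ β T s ∂(lineGauss θ β)) * (centredTilt θ β J) t ∂(lineGauss θ β))| ≤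
      8 * KF ^ 2 * KE * (⌈β ^ θ⌉₊ : ℝ) ^ 6 / β := by
    refine hAb.trans ?_
    have hA0 : 0 ≤ (∫ t, (obsF θ β t - ∫ s, obsF θ β s ∂(lineGauss θ β)) ^ 4 ∂(lineGauss θ β)) ^ (1 / 4 : ℝ) := Real.rpow_nonneg (integral_nonneg fun t => by positivity) _
    have hB0 : 0 ≤ (∫ t, (obsG θ β T t - ∫ s, obsG θ β T s ∂(lineGauss θ β)) ^ 4 ∂(lineGauss θ β)) ^ (1 / 4 : ℝ) := Real.rpow_nonneg (integral_nonneg fun t => by positivity) _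
    have hC0 : 0 ≤ (∫ t, (centredTilt θ β J) t ^ 8 ∂(lineGauss θ β)) ^ (1 / 4 : ℝ) := Real.rpow_nonneg (integral_nonneg fun t => by positivity) _
    have hD0 : 0 ≤ (∫ t, Real.exp (4 * |(centredTilt θ β J) t|) ∂(lineGauss θ β)) ^ (1 / 2 : ℝ) := Real.rpow_nonneg (integral_nonneg fun t => (Real.exp_pos _).le) _
    have hKEH : 0 ≤ KE * (⌈β ^ θ⌉₊ : ℝ) ^ 6 / β := div_nonneg (mul_nonneg hKE (pow_nonneg (Nat.cast_nonneg _) 6)) hβ0.le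
    have h4KF : (0 : ℝ) ≤ 4 * KF := mul_nonneg (by norm_num) hKF
    have h4KF2 : (0 : ℝ) ≤ 4 * KF * KF := mul_nonneg h4KF hKF
    calc 4 * (∫ t, (obsF θ β t - ∫ s, obsF θ β s ∂(lineGauss θ β)) ^ 4 ∂(lineGauss θ β)) ^ (1 / 4 : ℝ) *
          (∫ t, (obsG θ β T t - ∫ s, obsG θ β T s ∂(lineGauss θ β)) ^ 4 ∂(lineGauss θ β)) ^ (1 / 4 : ℝ) * (∫ t, (centredTilt θ β J) t ^ 8 ∂(lineGauss θ β)) ^ (1 / 4 : ℝ) *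
          (∫ t, Real.exp (4 * |(centredTilt θ β J) t|) ∂(lineGauss θ β)) ^ (1 / 2 : ℝ)
        ≤ 4 * KF * KF * (KE * (⌈β ^ θ⌉₊ : ℝ) ^ 6 / β) * 2 :=
          mul_le_mul (mul_le_mul (mul_le_mul (mul_le_mul_of_nonneg_left hF4 (by norm_num)) hG4 hB0 h4KF) hW8 hC0 h4KF2)
            hexp2 hD0 (mul_nonneg h4KF2 hKEH)
      _ = 8 * KF ^ 2 * KE * (⌈β ^ θ⌉₊ : ℝ) ^ 6 / β := by ring
  refine (abs_add_le _ _).trans ((add_le_add p1 ((abs_add_le _ _).trans (add_le_add ((abs_add_le _ _).trans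
    (add_le_add p2 hFiii)) hFii))).trans (le_of_eq ?_))
  ring


end Summit.QuantumFields.YangMills.Theorems.AllWindowsColdBoxBoxMidLine

end
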